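import Summits.AtomisticToContinuum.BoseEinsteinCondensation.Theses.BECInfDivCoherence
import Summits.AtomisticToContinuum.BoseEinsteinCondensation.Theorems.BECInfDivCoherenceLevyMassCondensationGrid
import Summits.AtomisticToContinuum.BoseEinsteinCondensation.Theorems.BECInfDivCoherenceLevyMassCondensationTranslation

/-!
# Crux `LevyNegativeMoment` (stmt-AtomisticToContinuum-9115) — the crux and its stub
# `stub_logClusterL1` each bound the grid mean of `log G_Ψ` (route `BECInfDivCoherence`,
# line `registered`, lead cycle 2; part 1 of 2, continued in `…LevyNegativeMomentTargetStrength.lean`)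

Write `G_Ψ(r) = Re ∫ conj Ψ(…, xᵢ + r, …) Ψ` for the translation coherence of a near-minimiser,
`F(j) = log G_Ψ((L/m) j)` on the grid `m = ⌊L/η⌋`, `h = L/m`, `ν̃_q = m⁻³ Σ_j F(j) cos(2π q·j/m)`.

* `InfDivGlue.waveNumber_le`, `InfDivGlue.sum_posPart_le_of_negMoment` — the grid wavenumbers are
  bounded ABOVE, `|k_q| = (2π/L)‖q̄‖ ≤ 2√3π m/L`, so the crux's `(−1)`-moment bound
  `Σ_(q≢0) ν̃⁺_q/|k_q| ≤ C` already bounds the total positive Lévy mass: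
  `Σ_(q≢0) ν̃⁺_q ≤ (2√3π m/L)·C ≤ (2√3π/η)·C`.
* `InfDivGlue.neg_gridMean_le_of_negMoment` — hence, with `F(0) = 0` (normalisation) and
  `Σ_q ν̃_q = F(0)`, the grid mean of `F` is `≥ −(2√3π m/L)·C` (no sign information on `ν̃` and no
  positivity of `G_Ψ` are needed: `Real.log` is total).
* `InfDivGlue.neg_gridMean_le_of_logCluster` — the registered stub `stub_logClusterL1`
  (`Σ_j |F(j) − c|·h/(1 + ‖j̄‖²) ≤ C₁` for some centring `c`) gives the same kind of bound,
  `mean F ≥ −(C₁/h)(1 + (1 + 3m²)/m³)`, by anchoring at `j = 0` (`|c|·h ≤ C₁`) and `w_j ≥ h/(1 + 3m²)`.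
* `gridMeanLog_of_levyNegativeMoment`, `gridMeanLog_of_logClusterL1` — the two bounds threaded
  through the items' quantifiers: an `N`- and `ρ`-uniform floor `−Λ(v, η)` under the grid mean of
  `log G_Ψ` of near-minimisers, at every grid scale `η` (`Λ = 2√3π C⁺/η`, resp. `5 C₁⁺/η`).

Part 2 turns such a floor plus positivity of the coherence into constant-mode BEC of
near-minimisers (the route target).  No claim is made about the truth of the crux or the stub.
-/

noncomputable section


namespace Summit.AtomisticToContinuum.BoseEinsteinCondensation.Theorems.InfDivGlue

open Finset Literature.MathematicalPhysics.QuantumManyBody.BoseGas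

/-! ### Finite-dimensional bookkeeping -/

/-- Crude ceiling of the grid wavenumbers: `(2π/L)‖q̄‖ ≤ 2√3π·m/L` (`q̄_k = min(q_k, m − q_k) ≤ m`).
[folklore] -/
theorem waveNumber_le {m : ℕ} {L : ℝ} (hL : 0 < L) (q : Fin 3 → Fin m) :
    2 * Real.pi / L * Real.sqrt (∑ k, ((min (q k : ℕ) (m - (q k : ℕ)) : ℕ) : ℝ) ^ 2) ≤
      2 * Real.sqrt 3 * Real.pi * m / L := by
  have hsum : (∑ k, ((min (q k : ℕ) (m - (q k : ℕ)) : ℕ) : ℝ) ^ 2) ≤ 3 * (m : ℝ) ^ 2 := by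
    have hterm : ∀ k, ((min (q k : ℕ) (m - (q k : ℕ)) : ℕ) : ℝ) ^ 2 ≤ (m : ℝ) ^ 2 := by
      intro k
      have h1 : ((min (q k : ℕ) (m - (q k : ℕ)) : ℕ) : ℝ) ≤ m := by
        exact_mod_cast (min_le_left _ _).trans (q k).isLt.le
      have h0 : (0 : ℝ) ≤ ((min (q k : ℕ) (m - (q k : ℕ)) : ℕ) : ℝ) := Nat.cast_nonneg _
      nlinarith
    calc (∑ k, ((min (q k : ℕ) (m - (q k : ℕ)) : ℕ) : ℝ) ^ 2) ≤ ∑ _k : Fin 3, (m : ℝ) ^ 2 :=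
          Finset.sum_le_sum fun k _ => hterm k
      _ = 3 * (m : ℝ) ^ 2 := by
          rw [Finset.sum_const, Finset.card_univ, Fintype.card_fin, nsmul_eq_mul, Nat.cast_ofNat]
  have hsqrt : Real.sqrt (∑ k, ((min (q k : ℕ) (m - (q k : ℕ)) : ℕ) : ℝ) ^ 2) ≤ Real.sqrt 3 * m :=
    calc Real.sqrt (∑ k, ((min (q k : ℕ) (m - (q k : ℕ)) : ℕ) : ℝ) ^ 2)
        ≤ Real.sqrt (3 * (m : ℝ) ^ 2) := Real.sqrt_le_sqrt hsum
      _ = Real.sqrt 3 * m := by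
          rw [Real.sqrt_mul (by norm_num), Real.sqrt_sq (Nat.cast_nonneg _)]
  have h2 : 0 < 2 * Real.pi / L := by positivity
  calc 2 * Real.pi / L * Real.sqrt (∑ k, ((min (q k : ℕ) (m - (q k : ℕ)) : ℕ) : ℝ) ^ 2)
      ≤ 2 * Real.pi / L * (Real.sqrt 3 * m) := mul_le_mul_of_nonneg_left hsqrt h2.le
    _ = 2 * Real.sqrt 3 * Real.pi * m / L := by ring

/-- **Total positive Lévy mass from the `(−1)`-moment.** Since every grid wavenumber is
`≤ 2√3π m/L`, a bound `Σ_(q≢0) ν⁺_q/|k_q| ≤ C` gives `Σ_(q≢0) ν⁺_q ≤ (2√3π m/L)·C`. [folklore] -/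
theorem sum_posPart_le_of_negMoment {m : ℕ} {L C : ℝ} (hL : 0 < L) (ν : (Fin 3 → Fin m) → ℝ)
    (hC : (∑ q : Fin 3 → Fin m with (∃ k, (q k : ℕ) ≠ 0), max (ν q) 0 /
      (2 * Real.pi / L * Real.sqrt (∑ k, ((min (q k : ℕ) (m - (q k : ℕ)) : ℕ) : ℝ) ^ 2))) ≤ C) :
    (∑ q : Fin 3 → Fin m with (∃ k, (q k : ℕ) ≠ 0), max (ν q) 0) ≤
      2 * Real.sqrt 3 * Real.pi * m / L * C := by
  set P := Finset.univ.filter fun q : Fin 3 → Fin m => ∃ k, (q k : ℕ) ≠ 0 with hP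
  set K : (Fin 3 → Fin m) → ℝ := fun q =>
    2 * Real.pi / L * Real.sqrt (∑ k, ((min (q k : ℕ) (m - (q k : ℕ)) : ℕ) : ℝ) ^ 2) with hK
  have hKpos : ∀ q ∈ P, 0 < K q := by
    intro q hq
    rw [hP, Finset.mem_filter] at hq
    have h1 := one_le_sum_centred_sq hq.2
    have hs : 0 < Real.sqrt (∑ k, ((min (q k : ℕ) (m - (q k : ℕ)) : ℕ) : ℝ) ^ 2) :=
      Real.sqrt_pos.2 (by linarith)
    simp only [hK]
    positivity
  have hKle : ∀ q, K q ≤ 2 * Real.sqrt 3 * Real.pi * m / L := fun q => waveNumber_le hL q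
  have hKmax : 0 ≤ 2 * Real.sqrt 3 * Real.pi * m / L := by positivity
  change ∑ q ∈ P, max (ν q) 0 / K q ≤ C at hC
  calc ∑ q ∈ P, max (ν q) 0 = ∑ q ∈ P, max (ν q) 0 / K q * K q := by
        refine Finset.sum_congr rfl fun q hq => ?_
        rw [div_mul_cancel₀ _ (hKpos q hq).ne']
    _ ≤ ∑ q ∈ P, max (ν q) 0 / K q * (2 * Real.sqrt 3 * Real.pi * m / L) :=
        Finset.sum_le_sum fun q hq =>
          mul_le_mul_of_nonneg_left (hKle q) (div_nonneg (le_max_right _ _) (hKpos q hq).le)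
    _ = 2 * Real.sqrt 3 * Real.pi * m / L * ∑ q ∈ P, max (ν q) 0 / K q := by
        rw [← Finset.sum_mul, mul_comm]
    _ ≤ 2 * Real.sqrt 3 * Real.pi * m / L * C := mul_le_mul_of_nonneg_left hC hKmax

/-- **Grid mean of `F` from the `(−1)`-moment of its Lévy weights.** If `F(0) = 0` and the positive
parts of the discrete Lévy weights `ν_q = m⁻³ Σ_j F(j) cos(2π q·j/m)` have `(−1)`-moment `≤ C`, then
`mean F = ν_0 = −Σ_(q≢0) ν_q ≥ −(2√3π m/L)·C` (total weight `Σ_q ν_q = F(0) = 0`). [folklore] -/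
theorem neg_gridMean_le_of_negMoment {m : ℕ} [NeZero m] {L C : ℝ} (hL : 0 < L)
    (F : (Fin 3 → Fin m) → ℝ) (hF0 : F 0 = 0)
    (hC : (∑ q : Fin 3 → Fin m with (∃ k, (q k : ℕ) ≠ 0),
      max ((∑ j : Fin 3 → Fin m, F j *
        Real.cos (2 * Real.pi * (∑ k, ((q k : ℕ) : ℝ) * ((j k : ℕ) : ℝ)) / m)) / (m : ℝ) ^ 3) 0 /
      (2 * Real.pi / L * Real.sqrt (∑ k, ((min (q k : ℕ) (m - (q k : ℕ)) : ℕ) : ℝ) ^ 2))) ≤ C) :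
    -(2 * Real.sqrt 3 * Real.pi * m / L * C) ≤ (∑ j : Fin 3 → Fin m, F j) / (m : ℝ) ^ 3 := by
  set ν : (Fin 3 → Fin m) → ℝ := fun q =>
    (∑ j : Fin 3 → Fin m, F j *
      Real.cos (2 * Real.pi * (∑ k, ((q k : ℕ) : ℝ) * ((j k : ℕ) : ℝ)) / m)) / (m : ℝ) ^ 3 with hνdef
  have hC' : (∑ q : Fin 3 → Fin m with (∃ k, (q k : ℕ) ≠ 0), max (ν q) 0 /
      (2 * Real.pi / L * Real.sqrt (∑ k, ((min (q k : ℕ) (m - (q k : ℕ)) : ℕ) : ℝ) ^ 2))) ≤ C := hC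
  have hmass := sum_posPart_le_of_negMoment hL ν hC'
  -- total weight `Σ_q ν_q = F 0 = 0`
  have hsumν : ∑ q : Fin 3 → Fin m, ν q = F 0 := sum_levyWeight F
  have hsplit := sum_eq_zero_add_sum_filter ν
  rw [hsumν, hF0] at hsplit
  have hle : (∑ q : Fin 3 → Fin m with (∃ k, (q k : ℕ) ≠ 0), ν q) ≤
      ∑ q : Fin 3 → Fin m with (∃ k, (q k : ℕ) ≠ 0), max (ν q) 0 :=
    Finset.sum_le_sum fun q _ => le_max_left _ _
  -- the grid mean of `F` is `ν 0`
  have hmean : (∑ j : Fin 3 → Fin m, F j) / (m : ℝ) ^ 3 = ν 0 := by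
    simp only [hνdef]
    congr 1
    refine Finset.sum_congr rfl fun j _ => ?_
    simp
  rw [hmean]
  linarith only [hsplit, hle, hmass]

/-- **Grid mean of `F` from the weighted-ℓ¹ log-cluster bound.** If `F(0) = 0` and
`Σ_j |F(j) − c|·h/(1 + ‖j̄‖²) ≤ C₁` (`h > 0`), then `mean F ≥ −(C₁/h)(1 + (1 + 3m²)/m³)`:
the `j = 0` term anchors the centring (`|c|·h ≤ C₁`) and `h/(1 + ‖j̄‖²) ≥ h/(1 + 3m²)`. [folklore] -/
theorem neg_gridMean_le_of_logCluster {m : ℕ} [NeZero m] {h C₁ c : ℝ} (hh : 0 < h)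
    (F : (Fin 3 → Fin m) → ℝ) (hF0 : F 0 = 0)
    (hC : (∑ j : Fin 3 → Fin m, |F j - c| *
      (h / (1 + ∑ k, ((min (j k : ℕ) (m - (j k : ℕ)) : ℕ) : ℝ) ^ 2))) ≤ C₁) :
    -(C₁ / h * (1 + (1 + 3 * (m : ℝ) ^ 2) / (m : ℝ) ^ 3)) ≤ (∑ j : Fin 3 → Fin m, F j) / (m : ℝ) ^ 3 := by
  have hmpos : (0 : ℝ) < m := by exact_mod_cast Nat.pos_of_ne_zero (NeZero.ne m)
  set w : (Fin 3 → Fin m) → ℝ := fun j =>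
    h / (1 + ∑ k, ((min (j k : ℕ) (m - (j k : ℕ)) : ℕ) : ℝ) ^ 2) with hw
  change ∑ j, |F j - c| * w j ≤ C₁ at hC
  have hwpos : ∀ j, 0 < w j := fun j => by simp only [hw]; positivity
  have hterm0 : ∀ j, 0 ≤ |F j - c| * w j := fun j => mul_nonneg (abs_nonneg _) (hwpos j).le
  -- anchoring at `j = 0`: `|c| h ≤ C₁`
  have hw0 : w 0 = h := by
    simp only [hw]
    have : (∑ k, ((min ((0 : Fin 3 → Fin m) k : ℕ) (m - ((0 : Fin 3 → Fin m) k : ℕ)) : ℕ) : ℝ) ^ 2) = 0 := by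
      refine Finset.sum_eq_zero fun k _ => ?_
      simp
    rw [this, add_zero, div_one]
  have hc : |c| * h ≤ C₁ := by
    have h0 := Finset.single_le_sum (f := fun j => |F j - c| * w j) (fun j _ => hterm0 j)
      (Finset.mem_univ (0 : Fin 3 → Fin m))
    simp only [hF0, zero_sub, abs_neg, hw0] at h0
    exact h0.trans hC
  have hc' : |c| ≤ C₁ / h := by rwa [le_div_iff₀ hh]
  -- weights from below: `w j ≥ h/(1 + 3m²)`
  have hwge : ∀ j, h / (1 + 3 * (m : ℝ) ^ 2) ≤ w j := by
    intro j
    simp only [hw]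
    refine div_le_div_of_nonneg_left hh.le (by positivity) ?_
    have hterm : ∀ k, ((min (j k : ℕ) (m - (j k : ℕ)) : ℕ) : ℝ) ^ 2 ≤ (m : ℝ) ^ 2 := by
      intro k
      have h1 : ((min (j k : ℕ) (m - (j k : ℕ)) : ℕ) : ℝ) ≤ m := by
        exact_mod_cast (min_le_left _ _).trans (j k).isLt.le
      have h0 : (0 : ℝ) ≤ ((min (j k : ℕ) (m - (j k : ℕ)) : ℕ) : ℝ) := Nat.cast_nonneg _
      nlinarith
    have hs : (∑ k, ((min (j k : ℕ) (m - (j k : ℕ)) : ℕ) : ℝ) ^ 2) ≤ 3 * (m : ℝ) ^ 2 :=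
      calc (∑ k, ((min (j k : ℕ) (m - (j k : ℕ)) : ℕ) : ℝ) ^ 2) ≤ ∑ _k : Fin 3, (m : ℝ) ^ 2 :=
            Finset.sum_le_sum fun k _ => hterm k
        _ = 3 * (m : ℝ) ^ 2 := by
            rw [Finset.sum_const, Finset.card_univ, Fintype.card_fin, nsmul_eq_mul, Nat.cast_ofNat]
    linarith
  -- `Σ_j |F j - c| ≤ C₁ (1 + 3m²)/h`
  have hdev : ∑ j : Fin 3 → Fin m, |F j - c| ≤ C₁ * (1 + 3 * (m : ℝ) ^ 2) / h := by
    have hD : 0 < h / (1 + 3 * (m : ℝ) ^ 2) := by positivity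
    have h1 : h / (1 + 3 * (m : ℝ) ^ 2) * ∑ j : Fin 3 → Fin m, |F j - c| ≤ C₁ := by
      rw [Finset.mul_sum]
      calc ∑ j : Fin 3 → Fin m, h / (1 + 3 * (m : ℝ) ^ 2) * |F j - c|
          ≤ ∑ j : Fin 3 → Fin m, |F j - c| * w j :=
            Finset.sum_le_sum fun j _ => by
              rw [mul_comm]; exact mul_le_mul_of_nonneg_left (hwge j) (abs_nonneg _)
        _ ≤ C₁ := hC
    rw [le_div_iff₀ hh]
    have := (le_div_iff₀' hD).mpr h1
    calc (∑ j : Fin 3 → Fin m, |F j - c|) * h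
        ≤ C₁ / (h / (1 + 3 * (m : ℝ) ^ 2)) * h := mul_le_mul_of_nonneg_right this hh.le
      _ = C₁ * (1 + 3 * (m : ℝ) ^ 2) := by field_simp
  -- `Σ_j F j ≥ m³ (-|c|) - Σ_j |F j - c|`
  have hcard : (Fintype.card (Fin 3 → Fin m) : ℝ) = (m : ℝ) ^ 3 := by
    rw [Fintype.card_fun, Fintype.card_fin, Fintype.card_fin, Nat.cast_pow]
  have hsumF : (m : ℝ) ^ 3 * (-|c|) - ∑ j : Fin 3 → Fin m, |F j - c| ≤ ∑ j : Fin 3 → Fin m, F j := by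
    have h1 : ∀ j : Fin 3 → Fin m, -|c| - |F j - c| ≤ F j := by
      intro j
      have := neg_abs_le (F j - c)
      have := neg_abs_le c
      linarith
    calc (m : ℝ) ^ 3 * (-|c|) - ∑ j : Fin 3 → Fin m, |F j - c|
        = ∑ j : Fin 3 → Fin m, (-|c| - |F j - c|) := by
          rw [Finset.sum_sub_distrib, Finset.sum_const, Finset.card_univ, nsmul_eq_mul, hcard]
      _ ≤ ∑ j : Fin 3 → Fin m, F j := Finset.sum_le_sum fun j _ => h1 j
  have hm3 : (0 : ℝ) < (m : ℝ) ^ 3 := by positivity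
  rw [le_div_iff₀ hm3]
  have hC₁ : 0 ≤ C₁ := (Finset.sum_nonneg fun j _ => hterm0 j).trans hC
  calc -(C₁ / h * (1 + (1 + 3 * (m : ℝ) ^ 2) / (m : ℝ) ^ 3)) * (m : ℝ) ^ 3
      = (m : ℝ) ^ 3 * (-(C₁ / h)) - C₁ * (1 + 3 * (m : ℝ) ^ 2) / h := by field_simp; ring
    _ ≤ (m : ℝ) ^ 3 * (-|c|) - ∑ j : Fin 3 → Fin m, |F j - c| := by
        have h1 : (m : ℝ) ^ 3 * (-(C₁ / h)) ≤ (m : ℝ) ^ 3 * (-|c|) :=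
          mul_le_mul_of_nonneg_left (by linarith) hm3.le
        linarith
    _ ≤ ∑ j : Fin 3 → Fin m, F j := hsumF

end Summit.AtomisticToContinuum.BoseEinsteinCondensation.Theorems.InfDivGlue

namespace Summit.AtomisticToContinuum.BoseEinsteinCondensation.Theorems

open MeasureTheory Filter Literature.MathematicalPhysics.QuantumManyBody.BoseGas InfDivGlue
open scoped ENNReal ComplexConjugate

/-! ### Threading through the items' quantifiers -/

/-- **The crux bounds the grid mean of `log G_Ψ`.** `LevyNegativeMoment` gives, for every admissible
`v` and grid scale `η > 0`, a constant `Λ = 2√3π·C⁺/η` (uniform in `N` and `ρ < ρ₀`) with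
`m⁻³ Σ_j log G_Ψ((L/m)j) ≥ −Λ` for near-minimisers — from `Σ_(q≢0) ν̃⁺_q ≤ (2√3π m/L)·C`,
`Σ_q ν̃_q = log G_Ψ(0) = 0` and `m/L ≤ 1/η`; no sign condition on `ν̃` and no positivity of `G_Ψ`
enter (`Real.log` is total). [folklore] -/
theorem gridMeanLog_of_levyNegativeMoment
    (h2 : Summit.AtomisticToContinuum.BoseEinsteinCondensation.Theses.BECInfDivCoherence.LevyNegativeMoment) :
    ∀ v : ℝ → ℝ≥0∞, IsRepulsiveFiniteRange v → ∀ η : ℝ, 0 < η → ∃ Λ : ℝ, ∃ ρ₀ : ℝ, 0 < ρ₀ ∧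
      ∀ ρ : ℝ, 0 < ρ → ρ < ρ₀ → ∀ᶠ N : ℕ in atTop, ∃ δ : ℝ≥0∞, 0 < δ ∧
        ∀ Ψ : PeriodicTrialState N (sideLength ρ N),
          periodicEnergy v Ψ ≤ periodicGroundStateEnergy v N (sideLength ρ N) + δ → ∀ i : Fin N,
            let L : ℝ := sideLength ρ N; let m : ℕ := ⌊L / η⌋₊;
            -Λ ≤ (∑ j : Fin 3 → Fin m, Real.log ((∫ X in cellN N L,
              conj (Ψ.ψ (Function.update X i (X i + latticeVec (L / m) (fun k => ((j k : ℕ) : ℤ))))) *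
                Ψ.ψ X).re)) / (m : ℝ) ^ 3 := by
  intro v hv η hη
  obtain ⟨C, ρ₂, hρ₂, H2⟩ := h2 v hv η hη
  refine ⟨2 * Real.sqrt 3 * Real.pi * max C 0 / η, ρ₂, hρ₂, fun ρ hρ hρ2 => ?_⟩
  filter_upwards [H2 ρ hρ hρ2, eventually_gt_atTop 0] with N hN2 hN
  obtain ⟨δ, hδ, H⟩ := hN2
  have hNpos : (0 : ℝ) < N := by exact_mod_cast hN
  have hLpos : 0 < sideLength ρ N := by
    unfold sideLength; exact Real.rpow_pos_of_pos (div_pos hNpos hρ) _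
  dsimp only at H ⊢
  generalize sideLength ρ N = L at H hLpos ⊢
  refine ⟨δ, hδ, fun Ψ hΨ i => ?_⟩
  have P := H Ψ hΨ i
  clear H H2
  have hmle : (⌊L / η⌋₊ : ℝ) ≤ L / η := Nat.floor_le (div_nonneg hLpos.le hη.le)
  generalize ⌊L / η⌋₊ = m at P hmle ⊢
  have hΛ : 0 ≤ 2 * Real.sqrt 3 * Real.pi * max C 0 / η := by positivity
  rcases Nat.eq_zero_or_pos m with hm | hm
  · subst hm
    simp only [Finset.univ_eq_empty, Finset.sum_empty, zero_div]
    linarith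
  haveI : NeZero m := ⟨hm.ne'⟩
  set G : Space → ℝ := fun r =>
    (∫ X in cellN N L, conj (Ψ.ψ (Function.update X i (X i + r))) * Ψ.ψ X).re with hGdef
  set F : (Fin 3 → Fin m) → ℝ := fun j =>
    Real.log (G (latticeVec (L / m) fun k => ((j k : ℕ) : ℤ))) with hFdef
  have hF0 : F 0 = 0 := by
    have h0 : (latticeVec (L / m) fun k => (((0 : Fin 3 → Fin m) k : ℕ) : ℤ)) = 0 := by
      rw [← latticeVec_zero (L / m)]; congr 1
    show Real.log (G (latticeVec (L / m) fun k => (((0 : Fin 3 → Fin m) k : ℕ) : ℤ))) = 0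
    rw [h0, hGdef]
    dsimp only
    rw [coh_zero Ψ i, Real.log_one]
  have P' : (∑ q : Fin 3 → Fin m with (∃ k, (q k : ℕ) ≠ 0),
      max ((∑ j : Fin 3 → Fin m, F j *
        Real.cos (2 * Real.pi * (∑ k, ((q k : ℕ) : ℝ) * ((j k : ℕ) : ℝ)) / m)) / (m : ℝ) ^ 3) 0 /
      (2 * Real.pi / L * Real.sqrt (∑ k, ((min (q k : ℕ) (m - (q k : ℕ)) : ℕ) : ℝ) ^ 2))) ≤ C := P
  have key := neg_gridMean_le_of_negMoment hLpos F hF0 P'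
  change -(2 * Real.sqrt 3 * Real.pi * max C 0 / η) ≤ (∑ j : Fin 3 → Fin m, F j) / (m : ℝ) ^ 3
  refine le_trans ?_ key
  rw [neg_le_neg_iff]
  have hmL : (m : ℝ) / L ≤ 1 / η := by
    rw [div_le_div_iff₀ hLpos hη, one_mul]
    rwa [le_div_iff₀ hη] at hmle
  calc 2 * Real.sqrt 3 * Real.pi * m / L * C
      ≤ 2 * Real.sqrt 3 * Real.pi * m / L * max C 0 :=
        mul_le_mul_of_nonneg_left (le_max_left _ _) (by positivity)
    _ = 2 * Real.sqrt 3 * Real.pi * max C 0 * ((m : ℝ) / L) := by ring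
    _ ≤ 2 * Real.sqrt 3 * Real.pi * max C 0 * (1 / η) :=
        mul_le_mul_of_nonneg_left hmL (by positivity)
    _ = 2 * Real.sqrt 3 * Real.pi * max C 0 / η := by ring

/-- **The registered stub `stub_logClusterL1` bounds the grid mean of `log G_Ψ`.** The weighted-ℓ¹
log-cluster bound of line `registered` (stated inline, verbatim the registered signature of
`stub_logClusterL1` = `Cruxes.LevyNegativeMoment.Birth.LogClusterL1`) gives the same uniform floor
with `Λ = 5·C₁⁺/η` (anchoring at `j = 0`, `h = L/m ≥ η`, `(1 + 3m²)/m³ ≤ 4`). [folklore] -/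
theorem gridMeanLog_of_logClusterL1
    (h1 : ∀ v : ℝ → ENNReal, Literature.MathematicalPhysics.QuantumManyBody.BoseGas.IsRepulsiveFiniteRange v → ∀ η : ℝ, 0 < η → ∃ C : ℝ, ∃ ρ₀ : ℝ, 0 < ρ₀ ∧ ∀ ρ : ℝ, 0 < ρ → ρ < ρ₀ → ∀ᶠ N : ℕ in Filter.atTop, ∃ δ : ENNReal, 0 < δ ∧ ∀ Ψ : Literature.MathematicalPhysics.QuantumManyBody.BoseGas.PeriodicTrialState N (Literature.MathematicalPhysics.QuantumManyBody.BoseGas.sideLength ρ N), Literature.MathematicalPhysics.QuantumManyBody.BoseGas.periodicEnergy v Ψ ≤ Literature.MathematicalPhysics.QuantumManyBody.BoseGas.periodicGroundStateEnergy v N (Literature.MathematicalPhysics.QuantumManyBody.BoseGas.sideLength ρ N) + δ → ∀ i : Fin N, let L : ℝ := Literature.MathematicalPhysics.QuantumManyBody.BoseGas.sideLength ρ N; let m : ℕ := ⌊L / η⌋₊; let G : EuclideanSpace ℝ (Fin 3) → ℝ := fun r => (∫ X in Literature.MathematicalPhysics.QuantumManyBody.BoseGas.cellN N L, conj (Ψ.ψ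 (Function.update X i (X i + r))) * Ψ.ψ X).re; ∃ c : ℝ, (∑ j : Fin 3 → Fin m, |Real.log (G (Literature.MathematicalPhysics.QuantumManyBody.BoseGas.latticeVec (L / m) (fun k => ((j k : ℕ) : ℤ)))) - c| * ((L / m) / (1 + ∑ k, ((min (j k : ℕ) (m - (j k : ℕ)) : ℕ) : ℝ) ^ 2))) ≤ C) :
    ∀ v : ℝ → ℝ≥0∞, IsRepulsiveFiniteRange v → ∀ η : ℝ, 0 < η → ∃ Λ : ℝ, ∃ ρ₀ : ℝ, 0 < ρ₀ ∧
      ∀ ρ : ℝ, 0 < ρ → ρ < ρ₀ → ∀ᶠ N : ℕ in atTop, ∃ δ : ℝ≥0∞, 0 < δ ∧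
        ∀ Ψ : PeriodicTrialState N (sideLength ρ N),
          periodicEnergy v Ψ ≤ periodicGroundStateEnergy v N (sideLength ρ N) + δ → ∀ i : Fin N,
            let L : ℝ := sideLength ρ N; let m : ℕ := ⌊L / η⌋₊;
            -Λ ≤ (∑ j : Fin 3 → Fin m, Real.log ((∫ X in cellN N L,
              conj (Ψ.ψ (Function.update X i (X i + latticeVec (L / m) (fun k => ((j k : ℕ) : ℤ))))) *
                Ψ.ψ X).re)) / (m : ℝ) ^ 3 := by
  intro v hv η hη
  obtain ⟨C₁, ρ₁, hρ₁, H1⟩ := h1 v hv η hη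
  refine ⟨5 * max C₁ 0 / η, ρ₁, hρ₁, fun ρ hρ hρ1 => ?_⟩
  filter_upwards [H1 ρ hρ hρ1, eventually_gt_atTop 0,
    (tendsto_sideLength_atTop hρ).eventually_ge_atTop η] with N hN1 hN hLη
  obtain ⟨δ, hδ, H⟩ := hN1
  have hNpos : (0 : ℝ) < N := by exact_mod_cast hN
  have hLpos : 0 < sideLength ρ N := by
    unfold sideLength; exact Real.rpow_pos_of_pos (div_pos hNpos hρ) _
  dsimp only at H ⊢
  generalize sideLength ρ N = L at H hLpos hLη ⊢
  refine ⟨δ, hδ, fun Ψ hΨ i => ?_⟩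
  have P := H Ψ hΨ i
  clear H H1
  have hmle : (⌊L / η⌋₊ : ℝ) ≤ L / η := Nat.floor_le (div_nonneg hLpos.le hη.le)
  have hm : 0 < ⌊L / η⌋₊ := Nat.floor_pos.2 (by rwa [le_div_iff₀ hη, one_mul])
  set m : ℕ := ⌊L / η⌋₊ with hmdef
  haveI : NeZero m := ⟨hm.ne'⟩
  have hmpos : (0 : ℝ) < m := by exact_mod_cast hm
  have hm1 : (1 : ℝ) ≤ m := by exact_mod_cast hm
  set G : Space → ℝ := fun r =>
    (∫ X in cellN N L, conj (Ψ.ψ (Function.update X i (X i + r))) * Ψ.ψ X).re with hGdef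
  set F : (Fin 3 → Fin m) → ℝ := fun j =>
    Real.log (G (latticeVec (L / m) fun k => ((j k : ℕ) : ℤ))) with hFdef
  have hF0 : F 0 = 0 := by
    have h0 : (latticeVec (L / m) fun k => (((0 : Fin 3 → Fin m) k : ℕ) : ℤ)) = 0 := by
      rw [← latticeVec_zero (L / m)]; congr 1
    show Real.log (G (latticeVec (L / m) fun k => (((0 : Fin 3 → Fin m) k : ℕ) : ℤ))) = 0
    rw [h0, hGdef]
    dsimp only
    rw [coh_zero Ψ i, Real.log_one]
  obtain ⟨c, P⟩ := P
  have P' : (∑ j : Fin 3 → Fin m, |F j - c| *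
      ((L / m) / (1 + ∑ k, ((min (j k : ℕ) (m - (j k : ℕ)) : ℕ) : ℝ) ^ 2))) ≤ C₁ := P
  have hh : 0 < L / m := div_pos hLpos hmpos
  have key := neg_gridMean_le_of_logCluster hh F hF0 P'
  change -(5 * max C₁ 0 / η) ≤ (∑ j : Fin 3 → Fin m, F j) / (m : ℝ) ^ 3
  refine le_trans ?_ key
  rw [neg_le_neg_iff]
  -- `C₁ ≥ 0`, `1/h ≤ 1/η`, `(1 + 3m²)/m³ ≤ 4`
  have hC₁ : C₁ ≤ max C₁ 0 := le_max_left _ _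
  have hC₀ : 0 ≤ max C₁ 0 := le_max_right _ _
  have hinvh : 1 / (L / m) ≤ 1 / η := by
    rw [one_div_le_one_div hh hη]
    rw [le_div_iff₀ hη] at hmle
    rw [le_div_iff₀ hmpos]
    linarith
  have hrat : (1 + 3 * (m : ℝ) ^ 2) / (m : ℝ) ^ 3 ≤ 4 := by
    rw [div_le_iff₀ (by positivity)]
    nlinarith
  calc C₁ / (L / m) * (1 + (1 + 3 * (m : ℝ) ^ 2) / (m : ℝ) ^ 3)
      ≤ max C₁ 0 / (L / m) * (1 + (1 + 3 * (m : ℝ) ^ 2) / (m : ℝ) ^ 3) := by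
        gcongr
    _ ≤ max C₁ 0 / (L / m) * 5 := by
        refine mul_le_mul_of_nonneg_left (by linarith) (div_nonneg hC₀ hh.le)
    _ = 5 * max C₁ 0 * (1 / (L / m)) := by ring
    _ ≤ 5 * max C₁ 0 * (1 / η) := mul_le_mul_of_nonneg_left hinvh (by positivity)
    _ = 5 * max C₁ 0 / η := by ring

end Summit.AtomisticToContinuum.BoseEinsteinCondensation.Theorems

end
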